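import Summits.ResolutionOfSingularities.ResolutionOfSingularities.Theorems.HomologicalConductorNoZenoIncidenceGraph
import Summits.ResolutionOfSingularities.ResolutionOfSingularities.Theorems.HomologicalConductorNoZenoContractionExcCurves
import Mathlib.Combinatorics.SimpleGraph.Acyclic
import HarnessLib

/-!
# Crux `NoZenoR` (stmt-ResolutionOfSingularities-19943), slot `stub_L1wCoreF`, (B1) split core, UP-6 — the SUBDIVISION CLAUSE:
# after blowing up the nodes, every new exceptional curve is adjacent to exactly its two old neighbours

Route `ResolutionOfSingularities/HomologicalConductor`, crux chain W4.4.  OURS (cell res-hironaka; lead res-L0-w44-lead-1 interface wish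
STATUS 19:19:36Z «F = the node curves ⊆ excCurvePoints, `∀ n ∈ F, ∃ a b ∈ OLD, a ≠ b ∧ Adj n a ∧ Adj n b ∧ ∀ c, Adj n c → c = a ∨ c = b`,
OLD ↔ excCurvePoints π via ρ»; split off from (o-UP6) by res-L0-w44-stub-3 19:20:33Z; planner res-L0-w44-plan-1 DESK WORDs 5/7/8);
AI-written, weaker than expert review; nothing of the manuscript under review (Hironaka 2017) is used and no Theses declaration is
asserted.  Def-free, `--supports 19943 --as helper`.

STYLE = the lead's `Contraction` (`…NoZenoContractionExcCurves`, p560245): PURE TOPOLOGICAL BOOKKEEPING.  The blow-up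
`ρ : W = X¹ → X` of the (finite, closed) node set enters only through the literal clauses it satisfies — exactly the hypotheses of
`Contraction` read backwards (`ρ` contracts the new curves `F` to the closed points `ρ(F)`): `hF : F ⊆ excCurvePoints ψ`,
`hfib : ∀ n ∈ F, ρ⁻¹{ρ n} = closure {n}` (the fibre over a node is ONE new curve), `hC : IsClosed (ρ '' F)`,
`hiso : IsIso (ρ ∣_ (ρ '' F)ᶜ)`, `hc : ρ n` closed, `[UniversallyClosed ρ]`, `hht` (points of `W` over the closed point have height
`≤ 1`).  No blow-up theory is used or asserted here; discharging these clauses for the actual blow-up at `closure (sepNodes π)` is the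
`IsSepX1Sandwiched` / UP-2 side.

* `apply_eq_of_specializes` — a specialisation of a new curve `n` lies over the node `ρ n`;
* `specializes_of_adj` (any neighbour `c` of a new curve `n` passes over its node: `ρ c ⤳ ρ n`), `adj_of_specializes` (conversely, an
  exceptional curve `c ≠ n` with `ρ c ⤳ ρ n` IS adjacent to `n` — `ρ` is closed and the fibre over the node is `closure {n}`),
  `adj_new_old_iff`; `not_adj_of_mem` (two new curves are never adjacent);
* **`subdivision_clause`** — if over every node EXACTLY TWO old curves pass (hypothesis `htwo`, stated downstairs on `X`), then every
  `n ∈ F` has exactly two neighbours in `incidenceGraph ψ`, both OLD (`∈ excCurvePoints ψ \ F`), the lifts of the two old curves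
  through `ρ n` (lifting/injectivity = the lead's `Contraction.excCurvePoints_eq_image` / `injOn_excCurvePoints_diff`);
* `not_adj_three_of_isAcyclic`, `exactlyTwo_of_isAcyclic` — DISCHARGE of `htwo` downstairs: if every node lies under two distinct
  exceptional curves (`𝒩₀`) and `incidenceGraph π` is ACYCLIC (UP-6, stub-3), no third curve passes (three curves through one point
  form a triangle), so `htwo` holds.

Old–old adjacencies are NOT claimed to disappear (tangent old curves stay adjacent after one blow-up); the interface does not ask.
References: J. Lipman, Publ. Math. IHÉS 36 (1969) §24 (p. 258) [`Lipman1969`] (context: the graph of the exceptional configuration).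
-/

noncomputable section

-- single-problem summit: the doubled namespace component `ResolutionOfSingularities` is forced
set_option linter.dupNamespace false

namespace Summit.ResolutionOfSingularities.ResolutionOfSingularities.Theorems.NoZeno.ExcCount

open CategoryTheory AlgebraicGeometry TopologicalSpace Topology IsLocalRing
open Literature.AlgebraicGeometry.Resolution

/-! ## Three exceptional curves through one point form a triangle: excluded by acyclicity -/

section Triangle

variable {V : Type*} {G : SimpleGraph V}

/-- In an ACYCLIC simple graph there is no triangle: pairwise adjacent `a, b, c` would give two distinct paths `a — b` and
`a — c — b` (`SimpleGraph.IsAcyclic.path_unique`). [folklore] -/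
theorem not_adj_three_of_isAcyclic (hG : G.IsAcyclic) {a b c : V} (hab : G.Adj a b) (hbc : G.Adj b c) (hca : G.Adj c a) :
    False := by
  classical
  -- the one-edge path `a — b`
  let p : G.Path a b := SimpleGraph.Path.singleton hab
  -- the two-edge path `a — c — b`
  have hcb : G.Adj c b := hbc.symm
  have hac : G.Adj a c := hca.symm
  have hq2 : (SimpleGraph.Walk.cons hcb SimpleGraph.Walk.nil : G.Walk c b).IsPath :=
    (SimpleGraph.Walk.cons_isPath_iff hcb _).mpr ⟨SimpleGraph.Walk.IsPath.nil, by
      rw [SimpleGraph.Walk.support_nil, List.mem_singleton]; exact hcb.ne⟩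
  have hq : (SimpleGraph.Walk.cons hac (SimpleGraph.Walk.cons hcb SimpleGraph.Walk.nil) : G.Walk a b).IsPath :=
    (SimpleGraph.Walk.cons_isPath_iff hac _).mpr ⟨hq2, by
      rw [SimpleGraph.Walk.support_cons, SimpleGraph.Walk.support_nil, List.mem_cons, List.mem_singleton]
      rintro (h | h)
      · exact hca.ne h.symm
      · exact hab.ne h⟩
  let q : G.Path a b := ⟨_, hq⟩
  have hpq : p = q := hG.path_unique p q
  have hlen := congrArg (fun r : G.Path a b => r.1.length) hpq
  simp [p, q, SimpleGraph.Path.singleton] at hlen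

end Triangle

/-! ## Downstairs: «exactly two old curves through each node» from `𝒩₀` + acyclicity -/

section Downstairs

variable {S : Type} [CommRing S] [IsLocalRing S] {X : Scheme.{0}} {π : X ⟶ Spec (.of S)}

/-- **Discharge of the «exactly two» hypothesis.**  If `incidenceGraph π` is acyclic and the point `z` lies under two DISTINCT
integral exceptional curves, then EXACTLY two exceptional curves pass through `z` (a third would close a triangle
`a — b — c — a`, all three meeting at `z`). [cite: Lipman1969, §24 (p. 258)] -/
theorem exactlyTwo_of_isAcyclic (hG : (incidenceGraph π).IsAcyclic) {z a b : X} (ha : a ∈ excCurvePoints π)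
    (hb : b ∈ excCurvePoints π) (hab : a ≠ b) (haz : a ⤳ z) (hbz : b ⤳ z) :
    ∀ c ∈ excCurvePoints π, c ⤳ z → c = a ∨ c = b := by
  intro c hc hcz
  by_contra hnot
  have hca : c ≠ a := fun h => hnot (Or.inl h)
  have hcb : c ≠ b := fun h => hnot (Or.inr h)
  exact not_adj_three_of_isAcyclic hG
    (exists_adj_of_two_curves_through hab ha hb haz hbz)
    (exists_adj_of_two_curves_through hcb.symm hb hc hbz hcz)
    (exists_adj_of_two_curves_through hca hc ha hcz haz)

end Downstairs

/-! ## The subdivision dictionary -/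

namespace Subdivision

variable {S : Type} [CommRing S] [IsLocalRing S] {W X : Scheme.{0}}
  (ψ : W ⟶ Spec (.of S)) (π : X ⟶ Spec (.of S)) (ρ : W ⟶ X) (hcomp : ρ ≫ π = ψ)
  {F : Set W} (hF : F ⊆ excCurvePoints ψ)
  (hfib : ∀ n ∈ F, ρ.base ⁻¹' {ρ.base n} = closure {n})
  (hC : IsClosed (ρ.base '' F))
  (hiso : IsIso (ρ ∣_ (⟨(ρ.base '' F)ᶜ, hC.isOpen_compl⟩ : X.Opens)))
  (hc : ∀ n ∈ F, IsClosed ({ρ.base n} : Set X))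

include hc in
/-- A specialisation `w` of a new curve `n ∈ F` lies over the node `ρ n` (the node is a closed point). [folklore] -/
theorem apply_eq_of_specializes {n w : W} (hn : n ∈ F) (hnw : n ⤳ w) : ρ.base w = ρ.base n := by
  have h := (hnw.map ρ.continuous).mem_closed (hc n hn) (Set.mem_singleton _)
  exact Set.mem_singleton_iff.mp h

include hc in
/-- **A neighbour of a new curve passes over its node**: if `n ∈ F` is adjacent to `c` in `incidenceGraph ψ`, then `ρ c ⤳ ρ n` — a
common specialisation `w` lies over `ρ n`, and `c ⤳ w`. [folklore] -/
theorem specializes_of_adj {n c : W} (hn : n ∈ F) (h : (incidenceGraph ψ).Adj n c) : ρ.base c ⤳ ρ.base n := by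
  obtain ⟨-, -, -, w, hnw, hcw⟩ := adj_iff_exists_mem.mp h
  rw [← apply_eq_of_specializes ρ hc hn hnw]
  exact hcw.map ρ.continuous

include hF hfib in
/-- **Conversely**: an exceptional curve `c ≠ n` of `ψ` whose image passes through the node, `ρ c ⤳ ρ n`, IS adjacent to the new curve
`n ∈ F` — `ρ` is a closed map, so some `w ∈ closure {c}` lies over `ρ n`, i.e. in the fibre `ρ⁻¹(ρ n) = closure {n}`. [folklore] -/
theorem adj_of_specializes [UniversallyClosed ρ] {n c : W} (hn : n ∈ F) (hcexc : c ∈ excCurvePoints ψ) (hne : n ≠ c)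
    (hsp : ρ.base c ⤳ ρ.base n) : (incidenceGraph ψ).Adj n c := by
  -- `ρ n ∈ closure {ρ c} = closure (ρ '' {c}) ⊆ ρ '' closure {c}`
  have hmem : ρ.base n ∈ ρ.base '' closure {c} := by
    refine (IsClosedMap.closure_image_subset ρ.isClosedMap {c}) ?_
    rw [Set.image_singleton]
    exact hsp.mem_closure
  obtain ⟨w, hwc, hw⟩ := hmem
  have hwn : w ∈ ρ.base ⁻¹' {ρ.base n} := hw
  rw [hfib n hn] at hwn
  exact exists_adj_of_two_curves_through hne (hF hn) hcexc (specializes_iff_mem_closure.mpr hwn)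
    (specializes_iff_mem_closure.mpr hwc)

include hF hfib hc in
/-- **New–old adjacency dictionary**: for a new curve `n ∈ F` and an exceptional curve `c ≠ n`:
`n — c` in `incidenceGraph ψ` iff `ρ c ⤳ ρ n`. [folklore] -/
theorem adj_new_old_iff [UniversallyClosed ρ] {n c : W} (hn : n ∈ F) (hcexc : c ∈ excCurvePoints ψ) (hne : n ≠ c) :
    (incidenceGraph ψ).Adj n c ↔ ρ.base c ⤳ ρ.base n :=
  ⟨specializes_of_adj ψ ρ hc hn, adj_of_specializes ψ ρ hF hfib hn hcexc hne⟩

include hF hfib hc in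
/-- **Two new curves are never adjacent**: a common specialisation would lie over both nodes, so the nodes agree, and then
`n′ ∈ ρ⁻¹(ρ n) = closure {n}` — impossible for distinct points of the same height `1`. [folklore] -/
theorem not_adj_of_mem {n n' : W} (hn : n ∈ F) (hn' : n' ∈ F) : ¬ (incidenceGraph ψ).Adj n n' := by
  intro h
  obtain ⟨hne, -, -, w, hnw, hn'w⟩ := adj_iff_exists_mem.mp h
  have h1 := apply_eq_of_specializes ρ hc hn hnw
  have h2 := apply_eq_of_specializes ρ hc hn' hn'w
  have hmem : n' ∈ ρ.base ⁻¹' {ρ.base n} := by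
    change ρ.base n' ∈ ({ρ.base n} : Set X)
    rw [← h1, h2]; exact Set.mem_singleton _
  rw [hfib n hn] at hmem
  have hh : Order.height n' = Order.height n := by rw [(hF hn').2, (hF hn).2]
  exact not_specializes_of_height_eq (Ne.symm hne) hh (by rw [(hF hn').2]; exact ENat.coe_lt_top 1)
    (specializes_iff_mem_closure.mpr hmem)

include hcomp hF hfib hiso hc in
/-- **THE SUBDIVISION CLAUSE.**  Assume over every node EXACTLY TWO old exceptional curves pass (`htwo`, downstairs on `X`:
`a ≠ b` in `excCurvePoints π` through `ρ n`, and every exceptional curve through `ρ n` is `a` or `b` — e.g. by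
`exactlyTwo_of_isAcyclic`).  Then every new curve `n ∈ F` has EXACTLY TWO neighbours in `incidenceGraph ψ`, both OLD
(`∈ excCurvePoints ψ ∖ F`): the lifts `a′, b′` of `a, b` along `ρ` (`Contraction.excCurvePoints_eq_image`: `excCurvePoints π = ρ(OLD)`,
`ρ` injective on OLD).  Lead's interface wording (STATUS 19:19:36Z) verbatim. [cite: Lipman1969, §24 (p. 258)] -/
theorem subdivision_clause [UniversallyClosed ρ]
    (hht : ∀ w : W, ψ.base w = closedPoint S → Order.height w ≤ 1)
    (htwo : ∀ n ∈ F, ∃ a b : X, a ∈ excCurvePoints π ∧ b ∈ excCurvePoints π ∧ a ≠ b ∧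
      a ⤳ ρ.base n ∧ b ⤳ ρ.base n ∧ ∀ c ∈ excCurvePoints π, c ⤳ ρ.base n → c = a ∨ c = b) :
    ∀ n ∈ F, ∃ a b : W, a ∈ excCurvePoints ψ \ F ∧ b ∈ excCurvePoints ψ \ F ∧ a ≠ b ∧
      (incidenceGraph ψ).Adj n a ∧ (incidenceGraph ψ).Adj n b ∧
      ∀ c : W, (incidenceGraph ψ).Adj n c → c = a ∨ c = b := by
  intro n hn
  obtain ⟨a, b, ha, hb, hab, haz, hbz, honly⟩ := htwo n hn
  have himg := Contraction.excCurvePoints_eq_image ψ π ρ hcomp hF hfib hC hiso hht hc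
  -- lift `a`, `b` to old curves upstairs
  have ha' : a ∈ ρ.base '' (excCurvePoints ψ \ F) := himg ▸ ha
  have hb' : b ∈ ρ.base '' (excCurvePoints ψ \ F) := himg ▸ hb
  obtain ⟨a', ha'old, rfl⟩ := ha'
  obtain ⟨b', hb'old, rfl⟩ := hb'
  have hna' : n ≠ a' := fun e => ha'old.2 (e ▸ hn)
  have hnb' : n ≠ b' := fun e => hb'old.2 (e ▸ hn)
  refine ⟨a', b', ha'old, hb'old, fun e => hab (by rw [e]), ?_, ?_, ?_⟩
  · exact adj_of_specializes ψ ρ hF hfib hn ha'old.1 hna' haz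
  · exact adj_of_specializes ψ ρ hF hfib hn hb'old.1 hnb' hbz
  · intro c hadj
    have hcexc : c ∈ excCurvePoints ψ := snd_mem_of_adj hadj
    -- `c` is old
    have hcF : c ∉ F := fun hcF => not_adj_of_mem ψ ρ hF hfib hc hn hcF hadj
    have hcold : c ∈ excCurvePoints ψ \ F := ⟨hcexc, hcF⟩
    -- its image passes through the node, hence is `ρ a′` or `ρ b′`
    have hρc : ρ.base c ∈ excCurvePoints π := himg ▸ ⟨c, hcold, rfl⟩
    have hsp : ρ.base c ⤳ ρ.base n := specializes_of_adj ψ ρ hc hn hadj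
    have hinj := Contraction.injOn_excCurvePoints_diff ψ ρ hF hfib hC hiso
    rcases honly _ hρc hsp with h | h
    · exact Or.inl (hinj hcold ha'old h)
    · exact Or.inr (hinj hcold hb'old h)

include hcomp hF hfib hiso hc in
/-- **The subdivision clause from acyclicity downstairs**: if `incidenceGraph π` is ACYCLIC (UP-6) and every node `ρ n`, `n ∈ F`,
lies under two DISTINCT exceptional curves of `π` (the `𝒩₀` condition of the split core), then every new curve has exactly two
neighbours, both old. [cite: Lipman1969, §24 (p. 258)] -/
theorem subdivision_clause_of_isAcyclic [UniversallyClosed ρ]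
    (hht : ∀ w : W, ψ.base w = closedPoint S → Order.height w ≤ 1)
    (hG : (incidenceGraph π).IsAcyclic)
    (hN₀ : ∀ n ∈ F, ∃ a b : X, a ∈ excCurvePoints π ∧ b ∈ excCurvePoints π ∧ a ≠ b ∧ a ⤳ ρ.base n ∧ b ⤳ ρ.base n) :
    ∀ n ∈ F, ∃ a b : W, a ∈ excCurvePoints ψ \ F ∧ b ∈ excCurvePoints ψ \ F ∧ a ≠ b ∧
      (incidenceGraph ψ).Adj n a ∧ (incidenceGraph ψ).Adj n b ∧
      ∀ c : W, (incidenceGraph ψ).Adj n c → c = a ∨ c = b := by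
  refine subdivision_clause ψ π ρ hcomp hF hfib hC hiso hc hht fun n hn => ?_
  obtain ⟨a, b, ha, hb, hab, haz, hbz⟩ := hN₀ n hn
  exact ⟨a, b, ha, hb, hab, haz, hbz, exactlyTwo_of_isAcyclic hG ha hb hab haz hbz⟩

end Subdivision

end Summit.ResolutionOfSingularities.ResolutionOfSingularities.Theorems.NoZeno.ExcCount

end
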